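import Summits.NavierStokesRegularity.NavierStokesRegularity.Theorems.RellichScarScarRigidityPaintedLadderMultipole
import Summits.NavierStokesRegularity.NavierStokesRegularity.Theorems.RellichScarScarRigidityPaintedLadderMomentIdentity
import Summits.NavierStokesRegularity.NavierStokesRegularity.Theorems.RellichScarScarRigidityPaintedLadderIteratedIBP
import HarnessLib

/-!
# `ScarRigidity`, line `moment-conditioned-rellich` — stub `stub_paintedLadderHigher` (PL≥2), part 9:
# the painted pressure gradient — the far field of `Dᵏ⁺¹(Q₁ − Q₂)` under the moment conditions

Crux stmt-NavierStokesRegularity-11717 (route RellichScar), helper file (`--supports`) for the registered stub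
`stub_paintedLadderHigher`.  THE PRESSURE PAINTING: for two classical Navier–Stokes pairs on the open backward slab with
the scale-invariant packages, flatness of order `N + 2` (`N ≥ 1`) and vanishing radiative moments of degrees
`2 ≤ ℓ' ≤ N`, on every slice `s < 0` and for every order `k`,

  `‖Dᵏ⁺¹(Q₁(s) − Q₂(s))(x)‖ ≤ P (√(−s))^N / ‖x‖^{N+3+k}`  on the parabolic exterior `√(−s) ≤ ‖x‖`

(`exists_pressureGradient_farField_bound`) — exactly the hypothesis of the time-integration step of part 1.  Proof, for a
component `Dᵏ⁺¹π(x)(e_J)`: it is `−∫ Γ(x − y) h_J(y) dy` with `h_J = Dᵏ⁺¹g(·)(e_J)`, `|h_J| ≤ C a⁻¹a^{N+2}/ρ^{N+6+k}` (parts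
2, 3); by the multipole expansion (part 5, order `M = N + 1 + k`) it is its Taylor series
`Σ_{m ≤ M} (−1)ᵐ/m! ∫ P_m^x h_J` up to `C a^N/‖x‖^{N+3+k}`; and EVERY TAYLOR MOMENT VANISHES
(`integral_newtonTaylorPoly_mul_eq_zero`): `∫ P_m^x Dᵏ⁺¹g(e_J) = (−1)ᵏ⁺¹ ∫ H g` with `H = Dᵏ⁺¹P_m^x(·)(e_J)` (part 8) a
solid harmonic of degree `m − k − 1 ≤ N` or zero (part 6), and `∫ H g = ∫ momentIntegrand H` (part 7) vanishes — for
degree `≤ 1` because `D²H = 0`, for degrees `2 … N` by hypothesis.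
-/

noncomputable section

open Set Filter Function MeasureTheory Metric TopologicalSpace
open scoped Topology ContDiff
open Literature.Analysis.FluidPDE

set_option linter.dupNamespace false -- D-0017: `Summit.<S>.<S>.…` repeats the summit name by design

-- nested operator types
set_option maxSynthPendingDepth 4

namespace Summit.NavierStokesRegularity.NavierStokesRegularity.Theorems.RellichScarScarRigidity

/-! ### The operator norm of a multilinear form through its components -/

/-- **`‖T‖ ≤ Σ_J |T(e_J)|`** for a continuous multilinear form on `ℝ³` (expand each argument in the standard basis;
`|vᵢⱼ| ≤ ‖vᵢ‖`). [folklore] -/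
theorem opNorm_le_sum_abs_apply_single {n : ℕ} (T : (EuclideanSpace ℝ (Fin 3)) [×n]→L[ℝ] ℝ) :
    ‖T‖ ≤ ∑ J : Fin n → Fin 3, |T fun i => EuclideanSpace.single (J i) (1 : ℝ)| := by
  classical
  refine ContinuousMultilinearMap.opNorm_le_bound (Finset.sum_nonneg fun J _ => abs_nonneg _) fun v => ?_
  have hv : ∀ i, v i = ∑ j, v i j • (EuclideanSpace.single j (1 : ℝ) : EuclideanSpace ℝ (Fin 3)) := by
    intro i
    conv_lhs => rw [← (EuclideanSpace.basisFun (Fin 3) ℝ).sum_repr (v i)]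
    simp
  have e : T v = T fun i => ∑ j, v i j • (EuclideanSpace.single j (1 : ℝ) : EuclideanSpace ℝ (Fin 3)) := by
    congr 1; funext i; exact hv i
  rw [e, ContinuousMultilinearMap.map_sum, Finset.sum_mul, Real.norm_eq_abs]
  refine (Finset.abs_sum_le_sum_abs _ _).trans (Finset.sum_le_sum fun J _ => ?_)
  rw [ContinuousMultilinearMap.map_smul_univ, smul_eq_mul, abs_mul, mul_comm]
  refine mul_le_mul_of_nonneg_left ?_ (abs_nonneg _)
  rw [Finset.abs_prod]
  exact Finset.prod_le_prod (fun i _ => abs_nonneg _) fun i _ => by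
    rw [← Real.norm_eq_abs]; exact PiLp.norm_apply_le (v i) (J i)

/-- The number of components. [folklore] -/
theorem sum_const_fin_fun (n : ℕ) (c : ℝ) : ∑ _J : Fin n → Fin 3, c = 3 ^ n * c := by
  rw [Finset.sum_const, Finset.card_univ, Fintype.card_fun, Fintype.card_fin, Fintype.card_fin, nsmul_eq_mul]
  push_cast
  ring

section Twins

variable {V₁ V₂ : ℝ → EuclideanSpace ℝ (Fin 3) → EuclideanSpace ℝ (Fin 3)}
  {Q₁ Q₂ : ℝ → EuclideanSpace ℝ (Fin 3) → ℝ}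

/-- The source bounds of part 2 with one constant for all orders `j ≤ n`. [folklore] -/
theorem exists_pressureDiffSource_bound_uniform (hcl₁ : IsClassicalNSSolutionOn (Iio (0 : ℝ)) 1 0 V₁ Q₁)
    (hcl₂ : IsClassicalNSSolutionOn (Iio (0 : ℝ)) 1 0 V₂ Q₂) (hB₁ : ScaleInvariantBounds V₁ Q₁)
    (hB₂ : ScaleInvariantBounds V₂ Q₂) (N : ℕ) (hF : FarDecay (N + 2) V₁ V₂) (n : ℕ) :
    ∃ C : ℝ, 0 ≤ C ∧ ∀ j ≤ n, ∀ t < 0, ∀ y : EuclideanSpace ℝ (Fin 3),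
      ‖iteratedFDeriv ℝ j (VectorCalculus.divergence fun y => convect (fun z => V₁ t z - V₂ t z) (V₁ t) y +
          convect (V₂ t) (fun z => V₁ t z - V₂ t z) y) y‖ ≤
        C * (Real.sqrt (-t))⁻¹ * Real.sqrt (-t) ^ (N + 2) / (‖y‖ + Real.sqrt (-t)) ^ (N + 5 + j) := by
  refine exists_forall_le_of_forall_exists
    (P := fun j C => ∀ t < 0, ∀ y : EuclideanSpace ℝ (Fin 3),
      ‖iteratedFDeriv ℝ j (VectorCalculus.divergence fun y => convect (fun z => V₁ t z - V₂ t z) (V₁ t) y +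
          convect (V₂ t) (fun z => V₁ t z - V₂ t z) y) y‖ ≤
        C * (Real.sqrt (-t))⁻¹ * Real.sqrt (-t) ^ (N + 2) / (‖y‖ + Real.sqrt (-t)) ^ (N + 5 + j))
    (fun j C C' hCC' hP t ht y => (hP t ht y).trans ?_) (fun j => ?_) n
  · have hσ : 0 < Real.sqrt (-t) := Real.sqrt_pos.2 (by linarith)
    exact div_le_div_of_nonneg_right (mul_le_mul_of_nonneg_right (mul_le_mul_of_nonneg_right hCC'
      (inv_nonneg.2 hσ.le)) (pow_nonneg hσ.le _)) (by positivity)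
  · obtain ⟨C, -, hC⟩ := exists_pressureDiffSource_bound hcl₁ hcl₂ hB₁ hB₂ N hF j
    exact ⟨C, hC⟩

/-- **Every Taylor moment of the source vanishes.**  Under the packages, flatness of order `N + 2` (`N ≥ 1`) and
vanishing radiative moments of degrees `2 … N`: for `s < 0`, `x ≠ 0`, directions `J` and `m ≤ N + 1 + k`,
`∫ P_m^x(y) Dᵏ⁺¹g(s,y)(J) dy = 0`, where `P_m^x(y) = DᵐΓ(x)(y,…,y)` and `g` is the source of the pressure Poisson
equation of the difference. [folklore] -/
theorem integral_newtonTaylorPoly_mul_eq_zero (hcl₁ : IsClassicalNSSolutionOn (Iio (0 : ℝ)) 1 0 V₁ Q₁)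
    (hcl₂ : IsClassicalNSSolutionOn (Iio (0 : ℝ)) 1 0 V₂ Q₂) (hB₁ : ScaleInvariantBounds V₁ Q₁)
    (hB₂ : ScaleInvariantBounds V₂ Q₂) {N : ℕ} (hN : 1 ≤ N) (hF : FarDecay (N + 2) V₁ V₂)
    (hmom : ∀ ℓ' : ℕ, 2 ≤ ℓ' → ℓ' ≤ N → RadiativeMomentsVanish ℓ' V₁ V₂) {s : ℝ} (hs : s < 0)
    {x : EuclideanSpace ℝ (Fin 3)} (hx : x ≠ 0) (k : ℕ) (J : Fin (k + 1) → EuclideanSpace ℝ (Fin 3)) {m : ℕ}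
    (hm : m ≤ N + 1 + k) :
    ∫ y, iteratedFDeriv ℝ m newtonKernel x (fun _ => y) *
        iteratedFDeriv ℝ (k + 1) (VectorCalculus.divergence fun y => convect (fun z => V₁ s z - V₂ s z) (V₁ s) y +
          convect (V₂ s) (fun z => V₁ s z - V₂ s z) y) y J = 0 := by
  have hσ : 0 < Real.sqrt (-s) := Real.sqrt_pos.2 (by linarith)
  set a : ℝ := Real.sqrt (-s) with ha_def
  set g : EuclideanSpace ℝ (Fin 3) → ℝ := VectorCalculus.divergence fun y =>
    convect (fun z => V₁ s z - V₂ s z) (V₁ s) y + convect (V₂ s) (fun z => V₁ s z - V₂ s z) y with hg_def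
  have hg : ContDiff ℝ ∞ g := contDiff_divergence_of_smooth (contDiff_defectFlux_slice hcl₁ hcl₂ hs)
  set P : EuclideanSpace ℝ (Fin 3) → ℝ := fun y => iteratedFDeriv ℝ m newtonKernel x (fun _ => y) with hP_def
  have hPsh : IsSolidHarmonic m P := isSolidHarmonic_newtonTaylorPoly hx m
  have hP : ContDiff ℝ ∞ P := hPsh.1
  have hPhom : ∀ r : ℝ, 0 < r → ∀ y, P (r • y) = r ^ m * P y := fun r hr y => hPsh.2.1 r y hr
  -- graded bounds: `‖DⁱP(y)‖ ≤ CP ‖y‖^r` for `m = i + r`, one constant for `i ≤ k + 1`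
  obtain ⟨CP, hCP0, hCP⟩ := exists_forall_le_of_forall_exists
    (P := fun i C => ∀ r : ℕ, m = i + r → ∀ y : EuclideanSpace ℝ (Fin 3), ‖iteratedFDeriv ℝ i P y‖ ≤ C * ‖y‖ ^ r)
    (fun i C C' hCC' h r hr y => (h r hr y).trans (mul_le_mul_of_nonneg_right hCC' (by positivity)))
    (fun i => by
      by_cases him : i ≤ m
      · obtain ⟨r, hr⟩ := Nat.exists_eq_add_of_le him
        obtain ⟨C, -, hC⟩ := exists_norm_iteratedFDeriv_le_of_homogeneous hP hPhom hr
        refine ⟨C, fun r' hr' y => ?_⟩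
        rw [show r' = r by omega]
        exact hC y
      · exact ⟨0, fun r hr y => absurd (hr ▸ Nat.le_add_right i r) him⟩) (k + 1)
  -- source bounds with one constant for `j ≤ k + 1`
  obtain ⟨Cg, hCg0, hCg⟩ := exists_pressureDiffSource_bound_uniform hcl₁ hcl₂ hB₁ hB₂ N hF (k + 1)
  set G : ℝ := Cg * a⁻¹ * a ^ (N + 2) with hG
  have hG0 : 0 ≤ G := by positivity
  set α : ℝ := (max 1 a⁻¹) ^ (N + k + 2) with hα
  have hα1 : 1 ≤ max 1 a⁻¹ := le_max_left _ _
  -- the product bounds for the iterated integration by parts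
  have hK : ∀ i j : ℕ, k + 1 ≤ i + j + 1 → i + j ≤ k + 1 → ∀ y,
      ‖iteratedFDeriv ℝ i P y‖ * ‖iteratedFDeriv ℝ j g y‖ ≤ CP * G * α / (‖y‖ + a) ^ 4 := by
    intro i j h1 h2 y
    have hρ : 0 < ‖y‖ + a := by positivity
    have hρa : a ≤ ‖y‖ + a := by linarith [norm_nonneg y]
    by_cases him : i ≤ m
    · obtain ⟨r, hr⟩ := Nat.exists_eq_add_of_le him
      have hPi := hCP i (by omega) r hr y
      have hgj := hCg j (by omega) s hs y
      -- `N + 5 + j = r + 4 + q`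
      obtain ⟨q, hq⟩ : ∃ q, N + 5 + j = r + 4 + q := ⟨N + 5 + j - (r + 4), by omega⟩
      have hqle : q ≤ N + k + 2 := by omega
      have hyr : ‖y‖ ^ r / (‖y‖ + a) ^ (N + 5 + j) ≤ α / (‖y‖ + a) ^ 4 := by
        rw [hq, show r + 4 + q = r + (4 + q) by ring, pow_add, pow_add, div_le_div_iff₀ (by positivity) (by positivity)]
        have h3 : ‖y‖ ^ r ≤ (‖y‖ + a) ^ r := pow_le_pow_left₀ (norm_nonneg _) (by linarith) r
        have h4 : (1 : ℝ) ≤ α * (‖y‖ + a) ^ q := by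
          have h5 : (1 : ℝ) ≤ (max 1 a⁻¹ * (‖y‖ + a)) ^ q := one_le_pow₀ (by
            calc (1 : ℝ) = a⁻¹ * a := (inv_mul_cancel₀ hσ.ne').symm
              _ ≤ max 1 a⁻¹ * (‖y‖ + a) := mul_le_mul (le_max_right _ _) hρa hσ.le (by positivity))
          rw [mul_pow] at h5
          refine h5.trans (mul_le_mul_of_nonneg_right ?_ (by positivity))
          exact pow_le_pow_right₀ hα1 hqle
        calc ‖y‖ ^ r * (‖y‖ + a) ^ 4 ≤ (‖y‖ + a) ^ r * (‖y‖ + a) ^ 4 * 1 := by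
              rw [mul_one]; exact mul_le_mul_of_nonneg_right h3 (by positivity)
          _ ≤ (‖y‖ + a) ^ r * (‖y‖ + a) ^ 4 * (α * (‖y‖ + a) ^ q) := mul_le_mul_of_nonneg_left h4 (by positivity)
          _ = α * ((‖y‖ + a) ^ r * ((‖y‖ + a) ^ 4 * (‖y‖ + a) ^ q)) := by ring
      calc ‖iteratedFDeriv ℝ i P y‖ * ‖iteratedFDeriv ℝ j g y‖
          ≤ (CP * ‖y‖ ^ r) * (Cg * a⁻¹ * a ^ (N + 2) / (‖y‖ + a) ^ (N + 5 + j)) :=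
            mul_le_mul hPi hgj (norm_nonneg _) (by positivity)
        _ = CP * G * (‖y‖ ^ r / (‖y‖ + a) ^ (N + 5 + j)) := by rw [hG]; ring
        _ ≤ CP * G * (α / (‖y‖ + a) ^ 4) := mul_le_mul_of_nonneg_left hyr (by positivity)
        _ = CP * G * α / (‖y‖ + a) ^ 4 := by ring
    · have h0 : iteratedFDeriv ℝ i P y = 0 :=
        iteratedFDeriv_eq_zero_of_homogeneous hP (fun r hr y => by rw [hPhom r hr y, smul_eq_mul]) (not_le.1 him) y
      rw [h0, norm_zero, zero_mul]
      positivity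
  obtain ⟨-, -, hEQ⟩ := integral_mul_iteratedFDeriv_apply_eq hσ (k + 1) P g hP hg (CP * G * α) hK J
  rw [hEQ]
  -- the weight `H = Dᵏ⁺¹P(·)(J)`
  set H : EuclideanSpace ℝ (Fin 3) → ℝ := fun y => iteratedFDeriv ℝ (k + 1) P y J with hH_def
  suffices hHg : ∫ y, H y * g y = 0 by
    simp only [hH_def] at hHg
    rw [hHg, mul_zero]
  by_cases hkm : m < k + 1
  · -- above the degree: `H = 0`
    have h0 : ∀ y, H y = 0 := fun y => iteratedFDeriv_apply_eq_zero_of_isSolidHarmonic hPsh hkm J y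
    simp_rw [h0, zero_mul, integral_zero]
  · obtain ⟨d, hd⟩ := Nat.exists_eq_add_of_le (not_lt.1 hkm)
    have hHsh : IsSolidHarmonic d H := isSolidHarmonic_iteratedFDeriv_apply hPsh hd J
    have hdN : d ≤ N := by omega
    have hHs : ContDiff ℝ ∞ H := hHsh.1
    have hHhom : ∀ r : ℝ, 0 < r → ∀ y, H (r • y) = r ^ d • H y := fun r hr y => by
      rw [hHsh.2.1 r y hr, smul_eq_mul]
    -- growth bounds of `H`, `DH`, `D²H`
    obtain ⟨C₀, hC₀0, hC₀⟩ := exists_norm_le_of_homogeneous hHs.continuous d hHhom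
    have one_le : ∀ y : EuclideanSpace ℝ (Fin 3), (1 : ℝ) ≤ 1 + ‖y‖ := fun y => by linarith [norm_nonneg y]
    have hnorm_le : ∀ (y : EuclideanSpace ℝ (Fin 3)) (e : ℕ), ‖y‖ ^ e ≤ (1 + ‖y‖) ^ e := fun y e =>
      pow_le_pow_left₀ (norm_nonneg _) (by linarith) e
    have hH0 : ∀ y, |H y| ≤ C₀ * (1 + ‖y‖) ^ N := fun y => by
      rw [← Real.norm_eq_abs]
      exact (hC₀ y).trans (mul_le_mul_of_nonneg_left ((hnorm_le y d).trans (pow_le_pow_right₀ (one_le y) hdN)) hC₀0)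
    -- the exponent `dd` of the derivative bounds: `d = 0 → dd = 0`, else `dd = d - 1`
    obtain ⟨dd, hdd, hdd'⟩ : ∃ dd : ℕ, dd + 1 ≤ N ∧ (d = 0 ∨ d = dd + 1) := by
      rcases Nat.eq_zero_or_pos d with h | h
      · exact ⟨0, by omega, Or.inl h⟩
      · exact ⟨d - 1, by omega, Or.inr (by omega)⟩
    obtain ⟨C₁, hC₁0, hC₁⟩ : ∃ C₁ : ℝ, 0 ≤ C₁ ∧ ∀ y, ‖fderiv ℝ H y‖ ≤ C₁ * (1 + ‖y‖) ^ dd := by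
      rcases hdd' with h0 | h1
      · refine ⟨0, le_rfl, fun y => ?_⟩
        have hz := iteratedFDeriv_eq_zero_of_homogeneous hHs hHhom (i := 1) (by omega) y
        rw [← norm_iteratedFDeriv_zero (𝕜 := ℝ) (f := fderiv ℝ H), norm_iteratedFDeriv_fderiv, hz, norm_zero, zero_mul]
      · obtain ⟨C₁, hC₁0, hC₁⟩ := exists_norm_iteratedFDeriv_le_of_homogeneous hHs
          (fun r hr y => by rw [hHhom r hr y, smul_eq_mul]) (i := 1) (r := dd) (by omega)
        refine ⟨C₁, hC₁0, fun y => ?_⟩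
        rw [← norm_iteratedFDeriv_zero (𝕜 := ℝ) (f := fderiv ℝ H), norm_iteratedFDeriv_fderiv]
        exact (hC₁ y).trans (mul_le_mul_of_nonneg_left (hnorm_le y dd) hC₁0)
    obtain ⟨C₂, hC₂0, hC₂⟩ : ∃ C₂ : ℝ, 0 ≤ C₂ ∧ ∀ y, ‖fderiv ℝ (fderiv ℝ H) y‖ ≤ C₂ * (1 + ‖y‖) ^ dd := by
      by_cases hd2 : d < 2
      · refine ⟨0, le_rfl, fun y => ?_⟩
        have hz := iteratedFDeriv_eq_zero_of_homogeneous hHs hHhom (i := 2) hd2 y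
        rw [← norm_iteratedFDeriv_zero (𝕜 := ℝ) (f := fderiv ℝ (fderiv ℝ H)), norm_iteratedFDeriv_fderiv,
          norm_iteratedFDeriv_fderiv, hz, norm_zero, zero_mul]
      · obtain ⟨r₂, hr₂⟩ := Nat.exists_eq_add_of_le (not_lt.1 hd2)
        obtain ⟨C₂, hC₂0, hC₂⟩ := exists_norm_iteratedFDeriv_le_of_homogeneous hHs
          (fun r hr y => by rw [hHhom r hr y, smul_eq_mul]) (i := 2) (r := r₂) hr₂
        refine ⟨C₂, hC₂0, fun y => ?_⟩
        rw [← norm_iteratedFDeriv_zero (𝕜 := ℝ) (f := fderiv ℝ (fderiv ℝ H)), norm_iteratedFDeriv_fderiv,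
          norm_iteratedFDeriv_fderiv]
        exact (hC₂ y).trans (mul_le_mul_of_nonneg_left ((hnorm_le y r₂).trans
          (pow_le_pow_right₀ (one_le y) (by omega))) hC₂0)
    set C : ℝ := max C₀ (max C₁ C₂) with hC
    have hId := integral_mul_pressureDiffSource_eq_integral_momentIntegrand hcl₁ hcl₂ hB₁ hB₂ N hF hs hHs (C := C)
      hdd (fun y => (hH0 y).trans (mul_le_mul_of_nonneg_right (le_max_left _ _) (by positivity)))
      (fun y => (hC₁ y).trans (mul_le_mul_of_nonneg_right (le_max_of_le_right (le_max_left _ _)) (by positivity)))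
      (fun y => (hC₂ y).trans (mul_le_mul_of_nonneg_right (le_max_of_le_right (le_max_right _ _)) (by positivity)))
    rw [hId.2.2]
    by_cases hd2 : d < 2
    · -- degree `≤ 1`: `D²H = 0`, so the moment integrand vanishes identically
      have hz : ∀ y, iteratedFDeriv ℝ 2 H y = 0 := fun y => iteratedFDeriv_eq_zero_of_homogeneous hHs hHhom hd2 y
      have h0 : ∀ y, momentIntegrand H V₁ V₂ s y = 0 := fun y => by
        unfold momentIntegrand
        simp [hz y]
      simp_rw [h0, integral_zero]
    · exact (hmom d (not_lt.1 hd2) hdN H hHsh s hs).2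

/-- **The painted pressure gradient (far field of `Dᵏ⁺¹(Q₁ − Q₂)`).**  For two classical Navier–Stokes pairs on
the open backward slab with the scale-invariant packages, flatness of order `N + 2` (`N ≥ 1`) and vanishing radiative
moments of degrees `2 ≤ ℓ' ≤ N`, for every `k` there is `P` with
`‖Dᵏ⁺¹(Q₁(s) − Q₂(s))(x)‖ ≤ P (√(−s))^N/‖x‖^{N+3+k}` for all `s < 0` and `√(−s) ≤ ‖x‖` (each component is minus the
Newtonian potential of `Dᵏ⁺¹g(·)(e_J)`, whose multipole series to order `N + 1 + k` vanishes term by term,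
`integral_newtonTaylorPoly_mul_eq_zero`, leaving the remainder of part 5). [folklore] -/
theorem exists_pressureGradient_farField_bound (hcl₁ : IsClassicalNSSolutionOn (Iio (0 : ℝ)) 1 0 V₁ Q₁)
    (hcl₂ : IsClassicalNSSolutionOn (Iio (0 : ℝ)) 1 0 V₂ Q₂) (hB₁ : ScaleInvariantBounds V₁ Q₁)
    (hB₂ : ScaleInvariantBounds V₂ Q₂) {N : ℕ} (hN : 1 ≤ N) (hF : FarDecay (N + 2) V₁ V₂)
    (hmom : ∀ ℓ' : ℕ, 2 ≤ ℓ' → ℓ' ≤ N → RadiativeMomentsVanish ℓ' V₁ V₂) (k : ℕ) :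
    ∃ P : ℝ, ∀ s < 0, ∀ x : EuclideanSpace ℝ (Fin 3), Real.sqrt (-s) ≤ ‖x‖ →
      ‖iteratedFDeriv ℝ (k + 1) (fun y => Q₁ s y - Q₂ s y) x‖ ≤ P * Real.sqrt (-s) ^ N / ‖x‖ ^ (N + 3 + k) := by
  obtain ⟨Cmp, hCmp0, hmp⟩ := newtonPotential_multipole_expansion (N + 1 + k)
  obtain ⟨Cg, hCg0, hCg⟩ := exists_pressureDiffSource_bound hcl₁ hcl₂ hB₁ hB₂ N hF (k + 1)
  refine ⟨3 ^ (k + 1) * (Cmp * Cg), fun s hs x hx => ?_⟩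
  have hσ : 0 < Real.sqrt (-s) := Real.sqrt_pos.2 (by linarith)
  set a : ℝ := Real.sqrt (-s) with ha_def
  have hx0 : 0 < ‖x‖ := hσ.trans_le hx
  have hxne : x ≠ 0 := norm_pos_iff.1 hx0
  set g : EuclideanSpace ℝ (Fin 3) → ℝ := VectorCalculus.divergence fun y =>
    convect (fun z => V₁ s z - V₂ s z) (V₁ s) y + convect (V₂ s) (fun z => V₁ s z - V₂ s z) y with hg_def
  have hg : ContDiff ℝ ∞ g := contDiff_divergence_of_smooth (contDiff_defectFlux_slice hcl₁ hcl₂ hs)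
  set B : ℝ := Cg * a⁻¹ * a ^ (N + 2) with hB
  have hB0 : 0 ≤ B := by positivity
  -- each component
  have hcomp : ∀ J : Fin (k + 1) → Fin 3,
      |iteratedFDeriv ℝ (k + 1) (fun y => Q₁ s y - Q₂ s y) x (fun i => EuclideanSpace.single (J i) (1 : ℝ))| ≤
        Cmp * Cg * a ^ N / ‖x‖ ^ (N + 3 + k) := by
    intro J
    set eJ : Fin (k + 1) → EuclideanSpace ℝ (Fin 3) := fun i => EuclideanSpace.single (J i) (1 : ℝ) with heJ
    set h : EuclideanSpace ℝ (Fin 3) → ℝ := fun y => iteratedFDeriv ℝ (k + 1) g y eJ with hh_def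
    have hhc : Continuous h :=
      (ContinuousMultilinearMap.apply ℝ (fun _ : Fin (k + 1) => EuclideanSpace ℝ (Fin 3)) ℝ eJ).continuous.comp
        (hg.continuous_iteratedFDeriv (by exact_mod_cast le_top))
    have hprod : ∏ i, ‖eJ i‖ = 1 := by simp [heJ]
    have hhb : ∀ y, |h y| ≤ B / (‖y‖ + a) ^ (N + 1 + k + 5) := fun y => by
      rw [show N + 1 + k + 5 = N + 5 + (k + 1) by ring, ← Real.norm_eq_abs]
      calc ‖h y‖ ≤ ‖iteratedFDeriv ℝ (k + 1) g y‖ * ∏ i, ‖eJ i‖ := ContinuousMultilinearMap.le_opNorm _ _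
        _ = ‖iteratedFDeriv ℝ (k + 1) g y‖ := by rw [hprod, mul_one]
        _ ≤ B / (‖y‖ + a) ^ (N + 5 + (k + 1)) := hCg s hs y
    obtain ⟨-, -, hrem⟩ := hmp h hhc a B hσ hB0 hhb x hx
    -- the Taylor moments vanish
    have hzero : ∑ m ∈ Finset.range (N + 1 + k + 1), (-1 : ℝ) ^ m / m.factorial *
        ∫ y, iteratedFDeriv ℝ m newtonKernel x (fun _ => y) * h y = 0 := by
      refine Finset.sum_eq_zero fun m hm => ?_
      have hmle : m ≤ N + 1 + k := Nat.lt_succ_iff.1 (Finset.mem_range.1 hm)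
      rw [hh_def]
      rw [integral_newtonTaylorPoly_mul_eq_zero hcl₁ hcl₂ hB₁ hB₂ hN hF hmom hs hxne k eJ hmle, mul_zero]
    rw [hzero, sub_zero] at hrem
    -- the representation
    rw [iteratedFDeriv_pressureDiff_apply_eq hcl₁ hcl₂ hB₁ hB₂ N hF (k + 1) hs x eJ, abs_neg]
    refine hrem.trans (le_of_eq ?_)
    rw [hB, show N + 1 + k + 2 = N + 3 + k by ring, pow_succ, pow_succ]
    field_simp
  calc ‖iteratedFDeriv ℝ (k + 1) (fun y => Q₁ s y - Q₂ s y) x‖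
      ≤ ∑ J : Fin (k + 1) → Fin 3, |iteratedFDeriv ℝ (k + 1) (fun y => Q₁ s y - Q₂ s y) x
          fun i => EuclideanSpace.single (J i) (1 : ℝ)| := opNorm_le_sum_abs_apply_single _
    _ ≤ ∑ _J : Fin (k + 1) → Fin 3, Cmp * Cg * a ^ N / ‖x‖ ^ (N + 3 + k) := Finset.sum_le_sum fun J _ => hcomp J
    _ = 3 ^ (k + 1) * (Cmp * Cg * a ^ N / ‖x‖ ^ (N + 3 + k)) := sum_const_fin_fun _ _
    _ = 3 ^ (k + 1) * (Cmp * Cg) * a ^ N / ‖x‖ ^ (N + 3 + k) := by ring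

end Twins

/-! ### Registered sub-goal -/

/-- **Registered helper stub `stub_paintedLadderPressureTools`** of `stub_paintedLadderHigher` (crux
stmt-NavierStokesRegularity-11717, line `moment-conditioned-rellich`): the painted pressure gradient — under the
packages, flatness of order `N + 2` (`N ≥ 1`) and vanishing radiative moments of degrees `2 … N`,
`‖Dᵏ⁺¹(Q₁(s) − Q₂(s))(x)‖ ≤ P(√(−s))^N/‖x‖^{N+3+k}` on the parabolic exterior. [folklore] -/
theorem stub_paintedLadderPressureTools :
    ∀ (V₁ V₂ : ℝ → EuclideanSpace ℝ (Fin 3) → EuclideanSpace ℝ (Fin 3)) (Q₁ Q₂ : ℝ → EuclideanSpace ℝ (Fin 3) → ℝ), IsClassicalNSSolutionOn (Iio (0 : ℝ)) 1 0 V₁ Q₁ → IsClassicalNSSolutionOn (Iio (0 : ℝ)) 1 0 V₂ Q₂ → ScaleInvariantBounds V₁ Q₁ → ScaleInvariantBounds V₂ Q₂ → ∀ N : ℕ, 1 ≤ N → FarDecay (N + 2) V₁ V₂ → (∀ ℓ' : ℕ, 2 ≤ ℓ' → ℓ' ≤ N → RadiativeMomentsVanish ℓ' V₁ V₂) → ∀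 k : ℕ, ∃ P : ℝ, ∀ s < 0, ∀ x : EuclideanSpace ℝ (Fin 3), Real.sqrt (-s) ≤ ‖x‖ → ‖iteratedFDeriv ℝ (k + 1) (fun y => Q₁ s y - Q₂ s y) x‖ ≤ P * Real.sqrt (-s) ^ N / ‖x‖ ^ (N + 3 + k) :=
  fun _V₁ _V₂ _Q₁ _Q₂ hcl₁ hcl₂ hB₁ hB₂ _N hN hF hmom k =>
    exists_pressureGradient_farField_bound hcl₁ hcl₂ hB₁ hB₂ hN hF hmom k

end Summit.NavierStokesRegularity.NavierStokesRegularity.Theorems.RellichScarScarRigidity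

end
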